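import Summits.Langlands.Langlands.Theses.TriangulineChamber
import Summits.Langlands.Langlands.Theorems.TriangulineChamberLiftB2CrysSplitPPeriods

/-!
# Birth skeleton (BC3) for piece `CyclotomicPinLocal` of the decomposition of `LiftB2CrysRamifiedP`
(stmt-Langlands-8574, crux-strategist).  The piece is restated verbatim as a local `def` (it is not
yet a route declaration); `stub_*` are the registered stubs (sorried); `CyclotomicPinLocal_of` is proved.
-/

set_option linter.dupNamespace false

namespace Summit.Langlands.Langlands.Cruxes.LiftB2CrysRamifiedP.BirthCyclotomicPinLocal

open Summit.Langlands Summit.Langlands.Langlands.Theses.TriangulineChamber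
open scoped Matrix Classical
open Filter Set Function

/-- piece CyclotomicPinLocal (verbatim; child of LiftB2CrysRamifiedP in the strategist split). -/
def CyclotomicPinLocal : Prop :=
  ∀ (F : Type) [Field F] [NumberField F] (p : ℕ) [Fact p.Prime] (v : IsDedekindDomain.HeightOneSpectrum (NumberField.RingOfIntegers F)) (hv : ((p : ℕ) : NumberField.RingOfIntegers F) ∈ v.asIdeal) (m : ℤ) (χv : Literature.NumberTheory.GaloisRepresentations.FramedGaloisRep (v.adicCompletion F) (PadicAlgCl p) 1), (∀ σ, (χv σ).val 0 0 = algebraMap ℚ_[p] (PadicAlgCl p) ((((Literature.NumberTheory.GaloisRepresentations.GaloisRep.cyclotomicCharacter (v.adicCompletion F) p σ : ℤ_[p]ˣ) : ℤ_[p]) : ℚ_[p]) ^ m)) → let D := Literature.NumberTheory.PAdicHodge.fontainePstAdicCompletion v p hv; letI := D.algebra; ∀ τ : v.adicCompletion F →ₐ[ℚ_[p]] PadicAlgCl p, D.𝔅.labelledHodgeTateWeights χv.toGaloisRep τ.toRingHom = {-m}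

/-- **The period of the cyclotomic character in THE datum** (stub): for the pinned datum
`D = fontainePstAdicCompletion v p hv` (whose period ring IS the constructed `B_dR(F_v)`,
`fontainePst_𝔅_eq_bdRPeriodRingData`) there is a unit `u` of the period ring (namely `t⁻¹`) with
`u ∈ Fil⁻¹`, `u⁻¹ ∈ Fil¹`, and `σ(u^m) = ε(σ)^{-m} u^m` for all integers `m` (tree:
`BdRCyclotomic.smul_tFrac`, `tFrac_inv_mem_fil_iff`, to be transported along the equation of data).
Fontaine 1994, Exp. II §1.5. -/
theorem stub_cyclotomicPeriod :
    ∀ (F : Type) [Field F] [NumberField F] (p : ℕ) [Fact p.Prime] (v :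
      IsDedekindDomain.HeightOneSpectrum (NumberField.RingOfIntegers F)) (hv : ((p : ℕ) :
      NumberField.RingOfIntegers F) ∈ v.asIdeal),
      let D := Literature.NumberTheory.PAdicHodge.fontainePstAdicCompletion v p hv;
      letI := D.algebra; ∃ u : (D.𝔅.B)ˣ, (u : D.𝔅.B) ∈ D.𝔅.fil (-1) ∧ ((u⁻¹ : (D.𝔅.B)ˣ) : D.𝔅.B)
      ∈ D.𝔅.fil 1 ∧ ∀ (m : ℤ) (σ : Field.absoluteGaloisGroup (v.adicCompletion F)), σ • ((u ^ m
      : (D.𝔅.B)ˣ) : D.𝔅.B) = algebraMap (v.adicCompletion F) D.𝔅.B (algebraMap ℚ_[p]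
      (v.adicCompletion F)
      (((((Literature.NumberTheory.GaloisRepresentations.GaloisRep.cyclotomicCharacter
      (v.adicCompletion F) p σ : ℤ_[p]ˣ) : ℤ_[p]) : ℚ_[p]) ^ m)⁻¹)) * ((u ^ m : (D.𝔅.B)ˣ) :
      D.𝔅.B) := by
  sorry

/-- **Rank-one dictionary "labelled weights = filtration degree of the period"** (stub): if a
rank-one `χ_v : Γ_{F_v} → GL₁(ℚ̄_p)` has entries `c(σ) ∈ ℚ_p` and `w` is a unit period with
`σ w = c(σ)⁻¹ w` and `w ∈ Fil^i ↔ i ≤ d`, then `x = 1 ⊗ w` spans `D(χ_v) = (ℚ̄_p ⊗ B)^Γ` over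
`F_v ⊗ ℚ̄_p`, every `τ`-component `D_τ` is the `ℚ̄_p`-line through `e_τ x`, and its filtration jumps
exactly at `d`: `HT_τ(χ_v) = {d}` for every `ℚ_p`-embedding `τ`.  Patrikis 2019 §2.3.1;
Fontaine 1994 Exp. III §1.5 (admissibility of rank-one objects). -/
theorem stub_rankOne_dictionary :
    ∀ (F : Type) [Field F] [NumberField F] (p : ℕ) [Fact p.Prime] (v :
      IsDedekindDomain.HeightOneSpectrum (NumberField.RingOfIntegers F)) (hv : ((p : ℕ) :
      NumberField.RingOfIntegers F) ∈ v.asIdeal) (c : Field.absoluteGaloisGroup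
      (v.adicCompletion F) → ℚ_[p]) (d : ℤ) (χv :
      Literature.NumberTheory.GaloisRepresentations.FramedGaloisRep (v.adicCompletion F)
      (PadicAlgCl p) 1), (∀ σ, (χv σ).val 0 0 = algebraMap ℚ_[p] (PadicAlgCl p) (c σ)) →
      let D := Literature.NumberTheory.PAdicHodge.fontainePstAdicCompletion v p hv;
      letI := D.algebra; ∀ w : (D.𝔅.B)ˣ, (∀ σ : Field.absoluteGaloisGroup (v.adicCompletion F),
      σ • (w : D.𝔅.B) = algebraMap (v.adicCompletion F) D.𝔅.B (algebraMap ℚ_[p]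
      (v.adicCompletion F) (c σ)⁻¹) * (w : D.𝔅.B)) → (∀ i : ℤ, (w : D.𝔅.B) ∈ D.𝔅.fil i ↔ i ≤ d)
      → ∀ τ : v.adicCompletion F →ₐ[ℚ_[p]] PadicAlgCl p, D.𝔅.labelledHodgeTateWeights
      χv.toGaloisRep τ.toRingHom = {d} := by
  sorry

/-- The piece from the two stubs: the period of `ε^m` is `u^m` (`u = t⁻¹`), of exact filtration
degree `-m` (`periodRing_zpow_mem_fil_iff` of the Periods helper file, from `u ∈ Fil⁻¹`,
`u⁻¹ ∈ Fil¹`), with `σ(u^m) = ε(σ)^{-m} u^m`; the dictionary stub with `c = ε^m`, `d = -m`. -/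
theorem CyclotomicPinLocal_of
    (h1 : ∀ (F : Type) [Field F] [NumberField F] (p : ℕ) [Fact p.Prime] (v :
      IsDedekindDomain.HeightOneSpectrum (NumberField.RingOfIntegers F)) (hv : ((p : ℕ) :
      NumberField.RingOfIntegers F) ∈ v.asIdeal),
      let D := Literature.NumberTheory.PAdicHodge.fontainePstAdicCompletion v p hv;
      letI := D.algebra; ∃ u : (D.𝔅.B)ˣ, (u : D.𝔅.B) ∈ D.𝔅.fil (-1) ∧ ((u⁻¹ : (D.𝔅.B)ˣ) : D.𝔅.B)
      ∈ D.𝔅.fil 1 ∧ ∀ (m : ℤ) (σ : Field.absoluteGaloisGroup (v.adicCompletion F)), σ • ((u ^ m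
      : (D.𝔅.B)ˣ) : D.𝔅.B) = algebraMap (v.adicCompletion F) D.𝔅.B (algebraMap ℚ_[p]
      (v.adicCompletion F)
      (((((Literature.NumberTheory.GaloisRepresentations.GaloisRep.cyclotomicCharacter
      (v.adicCompletion F) p σ : ℤ_[p]ˣ) : ℤ_[p]) : ℚ_[p]) ^ m)⁻¹)) * ((u ^ m : (D.𝔅.B)ˣ) :
      D.𝔅.B))
    (h2 : ∀ (F : Type) [Field F] [NumberField F] (p : ℕ) [Fact p.Prime] (v :
      IsDedekindDomain.HeightOneSpectrum (NumberField.RingOfIntegers F)) (hv : ((p : ℕ) :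
      NumberField.RingOfIntegers F) ∈ v.asIdeal) (c : Field.absoluteGaloisGroup
      (v.adicCompletion F) → ℚ_[p]) (d : ℤ) (χv :
      Literature.NumberTheory.GaloisRepresentations.FramedGaloisRep (v.adicCompletion F)
      (PadicAlgCl p) 1), (∀ σ, (χv σ).val 0 0 = algebraMap ℚ_[p] (PadicAlgCl p) (c σ)) →
      let D := Literature.NumberTheory.PAdicHodge.fontainePstAdicCompletion v p hv;
      letI := D.algebra; ∀ w : (D.𝔅.B)ˣ, (∀ σ : Field.absoluteGaloisGroup (v.adicCompletion F),
      σ • (w : D.𝔅.B) = algebraMap (v.adicCompletion F) D.𝔅.B (algebraMap ℚ_[p]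
      (v.adicCompletion F) (c σ)⁻¹) * (w : D.𝔅.B)) → (∀ i : ℤ, (w : D.𝔅.B) ∈ D.𝔅.fil i ↔ i ≤ d)
      → ∀ τ : v.adicCompletion F →ₐ[ℚ_[p]] PadicAlgCl p, D.𝔅.labelledHodgeTateWeights
      χv.toGaloisRep τ.toRingHom = {d}) :
    CyclotomicPinLocal := by
  intro F _ _ p _ v hv m χv hχ
  letI := (Literature.NumberTheory.PAdicHodge.fontainePstAdicCompletion v p hv).algebra
  obtain ⟨u, hu, hu', hgal⟩ := h1 F p v hv
  have key := h2 F p v hv (fun σ => (((Literature.NumberTheory.GaloisRepresentations.GaloisRep.cyclotomicCharacter (v.adicCompletion F) p σ : ℤ_[p]ˣ) : ℤ_[p]) : ℚ_[p]) ^ m) (-m) χv hχ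
  exact key (u ^ m) (hgal m) (fun i =>
    Summit.Langlands.Langlands.Theorems.LiftB2CrysSplitP.periodRing_zpow_mem_fil_iff _ u hu hu' m i)

end Summit.Langlands.Langlands.Cruxes.LiftB2CrysRamifiedP.BirthCyclotomicPinLocal
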